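import Summits.Ventures.Crystal3D.Theorems.StickyWulffConstantTextureLiminfTexShadowPresentationFlip
import HarnessLib

/-!
# TexShadow v6.17 vocabulary — `BothFcc` (both plates are fcc stackings) and the presentation of an fcc plate as an AFFINE fcc lattice
# (lane T, crux `TextureLiminf`, stmt-Ventures-19483; registered line `TexShadow`; cf-p1 g29 DECISION (xlv′), 22:01:30Z)

HONEST FRAMING. Venture `Summits/Ventures/Crystal3D` (cell `crystal3d-full`), helper `--supports` the crux `TextureLiminf`
(stmt-Ventures-19483) of `route-Ventures-StickyWulffConstant`, registered line `TexShadow`.  Rung credit only; F-C1 not moved.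
ONE definition, stated once for lanes T and G (19480-p2 imports it for the zig-keyed classes), plus the presentation lemmas the
`…Fcc` closers of the registered on-reach classes need to instantiate lane F's fcc|fcc slab law `CoaxialTwoSlabAdhesion`.

* `BothFcc σ₁ σ₂` — both presented Hägg words are SIGN-CONSTANT (`∀ k, σ k = σ 0`): both plates are fcc stackings (in the given or the
  basal-mirror presentation).  Why global and not «on the window»: the wall parts quantify over every cell radius `ρ ≥ R₀`, and a tilted
  plate shows every one of its fault planes inside a large enough window (wulff-p2 INBOX 22:4xZ (T1″)).
* `stacking_constHagg` — `stacking L s constHagg = (p ↦ L p + s) '' fccStacking 1 √(2/3)` (`rfl` up to names);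
* `stacking_const_neg` — the all-`(−1)` word presents the basal twin: `stacking L s (fun _ => −1) = (p ↦ (M∘L) p + s) '' fccStacking 1 √(2/3)`
  (`stacking_flip`, p663735);
* **`exists_affine_fcc_of_const`** — a sign-constant Hägg word presents an AFFINE fcc lattice: `∃ A ∈ {L, M∘L}, stacking L s σ =
  (p ↦ A p + s) '' fccStacking 1 √(2/3)` — exactly the plate shape `(fun q => A q + t) '' fccStacking 1 (Real.sqrt (2/3))` of
  `CoaxialTwoSlabAdhesion` / `AffineSampleDeficit`, with `t = s`.
WHAT THIS IS NOT: no wall statement; the `…Fcc` / `…Faulted` class cut is the skeleton's (v6.17); F-C1 not moved.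
-/

noncomputable section

namespace Summit.Ventures.Crystal3D.Cruxes.TextureLiminf.TexShadow

open Summit.Ventures.Crystal3D Summit.Ventures.Crystal3D.Theorems
open Literature.MathematicalPhysics.StatisticalMechanics (barlowStacking fccStacking constHagg basalMirror IsHaggSeq)

/-- **Both plates are fcc stackings**: both presented Hägg words are sign-constant. -/
def BothFcc (σ₁ σ₂ : ℤ → ℤ) : Prop := (∀ k : ℤ, σ₁ k = σ₁ 0) ∧ (∀ k : ℤ, σ₂ k = σ₂ 0)

/-- `BothFcc` is symmetric. -/
theorem BothFcc.symm {σ₁ σ₂ : ℤ → ℤ} (h : BothFcc σ₁ σ₂) : BothFcc σ₂ σ₁ := ⟨h.2, h.1⟩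

/-- A sign-constant Hägg word is the all-`(+1)` word or the all-`(−1)` word. -/
theorem eq_const_of_isHaggSeq {σ : ℤ → ℤ} (hσ : IsHaggSeq σ) (hc : ∀ k : ℤ, σ k = σ 0) :
    σ = (fun _ => 1) ∨ σ = (fun _ => -1) := by
  rcases hσ 0 with h | h
  · exact Or.inl (funext fun k => by rw [hc k, h])
  · exact Or.inr (funext fun k => by rw [hc k, h])

/-- The reversed word of a sign-constant word is sign-constant (so `BothFcc` is presentation-invariant). -/
theorem const_reverse {σ : ℤ → ℤ} (hc : ∀ k : ℤ, σ k = σ 0) : ∀ k : ℤ, (fun n => -σ (-n - 1)) k = (fun n => -σ (-n - 1)) 0 := by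
  intro k; simp only [hc (-k - 1), hc (-0 - 1)]

/-- The all-`(+1)` word presents the moved fcc lattice itself. -/
theorem stacking_constHagg (L : E3 ≃ₗᵢ[ℝ] E3) (s : E3) :
    stacking L s constHagg = (fun p => L p + s) '' fccStacking 1 (Real.sqrt (2 / 3)) := rfl

/-- `fun _ => 1` is `constHagg`. -/
theorem const_one_eq_constHagg : (fun _ : ℤ => (1 : ℤ)) = constHagg := rfl

/-- The all-`(−1)` word presents the BASAL TWIN: the fcc lattice moved by `M∘L` (`M` the basal mirror). -/
theorem stacking_const_neg (L : E3 ≃ₗᵢ[ℝ] E3) (s : E3) :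
    stacking L s (fun _ => -1) = (fun p => (basalMirror.trans L) p + s) '' fccStacking 1 (Real.sqrt (2 / 3)) := by
  have h := stacking_flip L s (fun _ => -1)
  simp only [neg_neg] at h
  rw [← h, const_one_eq_constHagg]
  rfl

/-- **A sign-constant Hägg word presents an AFFINE fcc lattice** `A·Λ₀ + s` with `A = L` or `A = M∘L`. -/
theorem exists_affine_fcc_of_const (L : E3 ≃ₗᵢ[ℝ] E3) (s : E3) {σ : ℤ → ℤ} (hσ : IsHaggSeq σ)
    (hc : ∀ k : ℤ, σ k = σ 0) :
    ∃ A : E3 ≃ₗᵢ[ℝ] E3, (A = L ∨ A = basalMirror.trans L) ∧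
      stacking L s σ = (fun p => A p + s) '' fccStacking 1 (Real.sqrt (2 / 3)) := by
  rcases eq_const_of_isHaggSeq hσ hc with rfl | rfl
  · exact ⟨L, Or.inl rfl, by rw [const_one_eq_constHagg]; rfl⟩
  · exact ⟨basalMirror.trans L, Or.inr rfl, stacking_const_neg L s⟩

/-- Under `BothFcc`, both plates are affine fcc lattices (the shape of `CoaxialTwoSlabAdhesion`'s plates). -/
theorem exists_affine_fcc_pair_of_bothFcc (L₁ L₂ : E3 ≃ₗᵢ[ℝ] E3) (s₁ s₂ : E3) {σ₁ σ₂ : ℤ → ℤ}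
    (hσ₁ : IsHaggSeq σ₁) (hσ₂ : IsHaggSeq σ₂) (h : BothFcc σ₁ σ₂) :
    ∃ A₁ A₂ : E3 ≃ₗᵢ[ℝ] E3, (A₁ = L₁ ∨ A₁ = basalMirror.trans L₁) ∧ (A₂ = L₂ ∨ A₂ = basalMirror.trans L₂) ∧
      stacking L₁ s₁ σ₁ = (fun p => A₁ p + s₁) '' fccStacking 1 (Real.sqrt (2 / 3)) ∧
      stacking L₂ s₂ σ₂ = (fun p => A₂ p + s₂) '' fccStacking 1 (Real.sqrt (2 / 3)) := by
  obtain ⟨A₁, hA₁, e₁⟩ := exists_affine_fcc_of_const L₁ s₁ hσ₁ h.1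
  obtain ⟨A₂, hA₂, e₂⟩ := exists_affine_fcc_of_const L₂ s₂ hσ₂ h.2
  exact ⟨A₁, A₂, hA₁, hA₂, e₁, e₂⟩

end Summit.Ventures.Crystal3D.Cruxes.TextureLiminf.TexShadow

end
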